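/-
Copyright: the b2b-balaban T⁴-continuum CRUX team, row NE7b OWNER lineage `t4-ne7b-p1` (gen 128). Project licence.
-/
import Summits.QuantumFields.BalabanUV.T4Continuum.Spine.NE7b.SupRegulatedActivityShift

/-!
# THE POLYMER GAS IS LOCAL IN THE CELL SET: `Z(C)` and `log Z(C)` depend only on the factors of the cells of `C`, so every hypothesis of
# (287)∕(289)∕(292) is needed ON `C` ONLY — in particular the SMALL-FIELD REGION THEOREM: if the external field is small on the cells of a
# region `C` (`Σ_{x∈cell p}ψ_x² ≤ Ψ²` for `p ∈ C`, nothing assumed elsewhere), then `Z_ψ(C) ≠ 0` and `‖log Z_ψ(C)‖ ≤ #C(Δ+1)2e·ε_ΨA_τ^v`,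
# uniformly in `C` and in such `ψ` (row NE7b, node U5c; the tree's `truncatedWeight_congr` ∕ `polymerLogZ_eq_sum_truncatedWeight` + (287)∕(289)∕(292)
# BY NAME applied to the factors CUT OFF outside `C`; [folklore])

Cell `pub-balaban`, sub-cell `t4`, spine estimate NE7b (`T4WeightBudget.RelWeightBound`; the cell's OWN estimate — NOT PRINTED in
[Bałaban 1983–89], NOT PROVED).  Crux-route work under `Spine/NE7b/` by the row OWNER (`t4-ne7b-p1` gen 128, file (296)) under FREEZE
(0)'s crux-prover clause, on § [NE7bP1-G127-HANDOFF] NEXT (3)(b); NOTHING of Bałaban's is named as a Lean object, valued or asserted; no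
`T4Continuum/Support` leaf typed; no `def`, no notation; zero `sorry`.  Imports (BY NAME): the OWNER's (292) `…SupRegulatedActivityShift`
(`shifted_regulated_of_small`-pattern, `shifted_measurable`, `shifted_regulated`), (289) (`regulated_pertZ_ne_zero`, `regulated_norm_pertLogZ_le`),
(287) (`act_norm_pertLogZ_le`); the tree's `pertZ`, `cellActivity`, `connActivity`, `pertLogZ`, `polymerLogZ_eq_sum_truncatedWeight`,
`truncatedWeight_congr`, `mem_rconnSubsets`.

WHY (located).  (292)'s small-external-field theorem asked `Σ_{cell p}ψ² ≤ Ψ²` for EVERY cell `p : V`; the multiscale bookkeeping needs it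
on a REGION: the cells are split into the small-field region `S(ψ)` and its complement, the expansion is run on `S(ψ)` and the complement
is bounded ((292) §3) and paid by (294)'s Peierls estimate.  Since `Z(C) = ∫∏_{p∈C}(1+g_p)` and the Kotecký–Preiss logarithm
`log Z(C) = Σ_{𝒞⊆𝒫(C)}Φ^T(𝒞)` see only activities of polymers inside `C`, replacing `g` by `g·1_C` changes nothing on `C` and makes every
hypothesis outside `C` vacuous — this file types that localisation once, for the activity, regulated and shifted layers.

WHAT IS PROVED ([folklore]; `g^C_p = g_p` for `p ∈ C`, `0` otherwise):
* §1 `prod_cutoff_eq` ∕ `cellActivity_cutoff_of_subset` (`K ⊆ C` ⟹ same products ∕ activities), `cellActivity_cutoff_of_not_subset`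
  (`K ⊄ C` ⟹ `M^C(K) = 0`), **`pertZ_cutoff`** (`Z^C(C) = Z(C)`), **`pertLogZ_cutoff`** (`log Z^C(C) = log Z(C)`);
* §2 activity level: **`act_norm_pertLogZ_le_on`** (`‖M(K)‖ ≤ ε^{#K}` for `R`-connected `K ⊆ C` ⟹ `‖log Z(C)‖ ≤ #C(Δ+1)2eε`);
* §3 regulated level over `N(0,Γ)`: `cutoff_regulated`, `cutoff_measurable`, **`regulated_pertZ_ne_zero_on`**, **`regulated_norm_pertLogZ_le_on`**
  (regulated bound and measurability required for `p ∈ C` only);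
* §4 THE SMALL-FIELD REGION THEOREM: `shifted_regulated_of_small_on`, `cutoff_shifted_regulated`, **`shifted_pertZ_ne_zero_on`**,
  **`shifted_norm_pertLogZ_le_on`** (external field small on the cells
  OF `C`: `Z_ψ(C) ≠ 0`, `‖log Z_ψ(C)‖ ≤ #C(Δ+1)2e·ε_ΨA_τ^v`, `ε_Ψ = εe^{½κ(1+τ⁻¹)Ψ²}`, `A_τ = (1−θ)^{−κ(1+τ)γ∕(2θ)}`); §5 toy.

HONEST (what this is NOT).  Bookkeeping (cut-off factors) on (287)∕(289)∕(292); the coupling of the region expansion with the large-field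
complement ((292) §3 + (294)) into ONE extensive bound for all `ψ`, and the iteration, are the successor's; scalar skeleton ((A3), NC-NE7b-α
UNRULED); nothing of Bałaban's asserted.  BY-NAME EFFECT ON THE WALL: NONE.  NE7b NOT PRINTED ∕ NOT PROVED; spine PROVED 0∕9; rung (B)+1 — the
programme's measures remain FINITE-torus statements; NOT the mass gap, NOT Clay.  HONEST DEPENDENCY: continuum YM on T⁴ ⇐ BetaPertH ∧ nine spine
estimates (0∕9 proved); BetaPertH ⇐ (D1) ∧ (D4) ∧ CAP+tail; G-an2-4 gates asym, D1 and NE2∕3∕4.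
-/

set_option autoImplicit false

noncomputable section

namespace Summit.QuantumFields.BalabanUV.T4Continuum.NE7b.SupLocalisedPolymerGas

open MeasureTheory ProbabilityTheory Finset Real
open scoped BigOperators
open Literature.Probability.LatticeModels (Touches GeomInc IsRConnected pertZ cellActivity connActivity pertLogZ rconnSubsets
  mem_rconnSubsets polymerPartitionFunction polymerLogZ_eq_sum_truncatedWeight truncatedWeight_congr)
open Literature.Analysis.Matrix (HasFiniteRange)
open SupActivityPolymerGas (act_norm_pertLogZ_le)
open SupRegulatedActivityBound (regulated_pertZ_ne_zero regulated_norm_pertLogZ_le)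
open SupRegulatedActivityShift (shifted_regulated shifted_measurable)

variable {V : Type*} [DecidableEq V] {Ω : Type*} [MeasurableSpace Ω]

/-! ## §1. Cutting the factors off outside `C` changes neither `Z(C)` nor `log Z(C)` -/

omit [MeasurableSpace Ω] in
/-- On `K ⊆ C` the cut-off products agree with the original ones. [folklore] -/
theorem prod_cutoff_eq (g : V → Ω → ℂ) {C K : Finset V} (hKC : K ⊆ C) (ω : Ω) :
    ∏ p ∈ K, (if p ∈ C then g p ω else 0) = ∏ p ∈ K, g p ω :=
  prod_congr rfl fun p hp => by rw [if_pos (hKC hp)]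

/-- On `K ⊆ C` the cut-off activities agree with the original ones. [folklore] -/
theorem cellActivity_cutoff_of_subset (μ : Measure Ω) (g : V → Ω → ℂ) {C K : Finset V} (hKC : K ⊆ C) :
    cellActivity μ (fun p ω => if p ∈ C then g p ω else 0) K = cellActivity μ g K := by
  unfold cellActivity
  exact integral_congr_ae (ae_of_all _ fun ω => prod_cutoff_eq g hKC ω)

/-- Off `C` the cut-off activities vanish: `K ⊄ C ⟹ M^C(K) = 0`. [folklore] -/
theorem cellActivity_cutoff_of_not_subset (μ : Measure Ω) (g : V → Ω → ℂ) {C K : Finset V} (hKC : ¬ K ⊆ C) :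
    cellActivity μ (fun p ω => if p ∈ C then g p ω else 0) K = 0 := by
  obtain ⟨p, hpK, hpC⟩ := not_subset.1 hKC
  unfold cellActivity
  exact integral_eq_zero_of_ae (ae_of_all _ fun ω => prod_eq_zero hpK (by simp only [hpC, if_false]))

/-- **`Z(C)` IS LOCAL**: `Z^C(C) = Z(C)`. [folklore] -/
theorem pertZ_cutoff (μ : Measure Ω) (g : V → Ω → ℂ) (C : Finset V) :
    pertZ μ (fun p ω => if p ∈ C then g p ω else 0) C = pertZ μ g C := by
  unfold pertZ
  exact integral_congr_ae (ae_of_all _ fun ω => prod_congr rfl fun p hp => by simp only [hp, if_true])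

/-- **`log Z(C)` IS LOCAL**: the Kotecký–Preiss logarithm of the cut-off factors on `C` is that of the original factors (every polymer of
`C` lies inside `C`). [folklore] -/
theorem pertLogZ_cutoff (μ : Measure Ω) (g : V → Ω → ℂ) (R : V → V → Prop) [DecidableRel R] (C : Finset V) :
    pertLogZ μ (fun p ω => if p ∈ C then g p ω else 0) R C = pertLogZ μ g R C := by
  unfold pertLogZ
  rw [polymerLogZ_eq_sum_truncatedWeight, polymerLogZ_eq_sum_truncatedWeight]
  refine sum_congr rfl fun 𝒞 h𝒞 => truncatedWeight_congr fun X hX => ?_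
  have hXC : X ⊆ C := (mem_rconnSubsets.1 (mem_powerset.1 h𝒞 hX)).1
  unfold connActivity
  split_ifs
  · exact cellActivity_cutoff_of_subset μ g hXC
  · rfl

/-! ## §2. Activity level: hypotheses on `C` only -/

/-- **EXTENSIVITY FROM ACTIVITY BOUNDS ON `C` ONLY**: `‖∫∏_{p∈K}g_p dμ‖ ≤ ε^{#K}` for `R`-connected `K ⊆ C`, `0 ≤ ε`, `eε(Δ+1)² ≤ 1∕2`,
`R` symmetric with `≤ Δ` neighbours ⟹ `‖log Z(C)‖ ≤ #C(Δ+1)2eε`. [folklore] -/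
theorem act_norm_pertLogZ_le_on {μ : Measure Ω} {R : V → V → Prop} [DecidableRel R] (hR : ∀ x y, R x y → R y x)
    {nbr : V → Finset V} {Δ : ℕ} (hΔ : ∀ x, (nbr x).card ≤ Δ) (hnbr : ∀ x y, R x y → y ∈ nbr x) {g : V → Ω → ℂ} {ε : ℝ}
    (C : Finset V) (hact : ∀ K : Finset V, K ⊆ C → IsRConnected R K → ‖cellActivity μ g K‖ ≤ ε ^ K.card) (hε : 0 ≤ ε)
    (hsmall : Real.exp 1 * ε * ((Δ : ℝ) + 1) ^ 2 ≤ 1 / 2) :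
    ‖pertLogZ μ g R C‖ ≤ C.card * ((Δ : ℝ) + 1) * (2 * (Real.exp 1 * ε)) := by
  rw [← pertLogZ_cutoff μ g R C]
  refine act_norm_pertLogZ_le hR hΔ hnbr (fun K hK => ?_) hε hsmall C
  by_cases hKC : K ⊆ C
  · rw [cellActivity_cutoff_of_subset μ g hKC]; exact hact K hKC hK
  · rw [cellActivity_cutoff_of_not_subset μ g hKC, norm_zero]; exact pow_nonneg hε _

/-! ## §3. Regulated level over a finite-range Gaussian field: hypotheses on `C` only -/

section Regulated

variable {ι : Type} [Fintype ι] [DecidableEq ι]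

omit [Fintype ι] [DecidableEq ι] in
/-- The cut-off factors are regulated everywhere if the factors are regulated on `C` (`0 ≤ ε`). [folklore] -/
theorem cutoff_regulated (cell : V → Finset ι) {g : V → EuclideanSpace ℝ ι → ℂ} {ε κ : ℝ} (hε : 0 ≤ ε) (C : Finset V)
    (hreg : ∀ p ∈ C, ∀ ω, ‖g p ω‖ ≤ ε * exp (κ * (∑ x ∈ cell p, ω x ^ 2) / 2)) (p : V) (ω : EuclideanSpace ℝ ι) :
    ‖(if p ∈ C then g p ω else 0)‖ ≤ ε * exp (κ * (∑ x ∈ cell p, ω x ^ 2) / 2) := by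
  split_ifs with hp
  · exact hreg p hp ω
  · rw [norm_zero]; positivity

omit [Fintype ι] [DecidableEq ι] in
/-- The cut-off factors are cell-measurable if the factors are cell-measurable on `C`. [folklore] -/
theorem cutoff_measurable (cell : V → Finset ι) {g : V → EuclideanSpace ℝ ι → ℂ} (C : Finset V)
    (hmeas : ∀ p ∈ C, Measurable[MeasurableSpace.comap (fun (ω : EuclideanSpace ℝ ι) (x : cell p) => ω x) inferInstance] (g p))
    (p : V) : Measurable[MeasurableSpace.comap (fun (ω : EuclideanSpace ℝ ι) (x : cell p) => ω x) inferInstance]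
      (fun ω => if p ∈ C then g p ω else 0) := by
  by_cases hp : p ∈ C
  · simp only [hp, if_true]; exact hmeas p hp
  · simp only [hp, if_false]; exact measurable_const

/-- **ZERO-FREENESS WITH HYPOTHESES ON `C` ONLY** (regulated level): `Γ ⪰ 0` of range `ρ`, `Γ ⪯ γ_op·1`, diagonal `≤ γ`; disjoint cells of
`≤ v` sites; `R` symmetric covering `ρ`-closeness with `≤ Δ` neighbours; factors cell-measurable and regulated ON `C`; `0 ≤ ε`, `0 ≤ κ`,
`0 < θ < 1`, `κγ_op ≤ θ`, `e·εA^v·(Δ+1)² ≤ 1∕2` ⟹ `Z(C) ≠ 0`. [folklore] -/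
theorem regulated_pertZ_ne_zero_on {Γ : Matrix ι ι ℝ} {γop γ : ℝ} (hΓ : Γ.PosSemidef)
    (hΓop : (γop • (1 : Matrix ι ι ℝ) - Γ).PosSemidef) (hdiag : ∀ i, Γ i i ≤ γ) (hγ : 0 ≤ γ) {dι : ι → ι → ℕ} {ρ : ℕ}
    (hfr : HasFiniteRange dι ρ Γ) (cell : V → Finset ι) (hdisj : ∀ p q, p ≠ q → Disjoint (cell p) (cell q)) {v : ℕ}
    (hv : ∀ p, (cell p).card ≤ v) {R : V → V → Prop} [DecidableRel R] (hRsymm : ∀ x y, R x y → R y x)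
    (hR : ∀ (p p' : V) (x y : ι), x ∈ cell p → y ∈ cell p' → dι x y ≤ ρ → p = p' ∨ R p p') {nbr : V → Finset V} {Δ : ℕ}
    (hΔ : ∀ x, (nbr x).card ≤ Δ) (hnbr : ∀ x y, R x y → y ∈ nbr x)
    {g : V → EuclideanSpace ℝ ι → ℂ} {ε κ θ : ℝ} (hε : 0 ≤ ε) (hκ : 0 ≤ κ) (hθ0 : 0 < θ) (hθ1 : θ < 1) (hκθ : κ * γop ≤ θ)
    (C : Finset V)
    (hmeas : ∀ p ∈ C, Measurable[MeasurableSpace.comap (fun (ω : EuclideanSpace ℝ ι) (x : cell p) => ω x) inferInstance] (g p))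
    (hreg : ∀ p ∈ C, ∀ ω, ‖g p ω‖ ≤ ε * exp (κ * (∑ x ∈ cell p, ω x ^ 2) / 2))
    (hsmall : Real.exp 1 * (ε * ((1 - θ) ^ (-(κ * γ / (2 * θ)))) ^ v) * ((Δ : ℝ) + 1) ^ 2 ≤ 1 / 2) :
    pertZ (multivariateGaussian 0 Γ) g C ≠ 0 := by
  rw [← pertZ_cutoff]
  exact regulated_pertZ_ne_zero hΓ hΓop hdiag hγ hfr cell hdisj hv hRsymm hR hΔ hnbr hε hκ hθ0 hθ1 hκθ (cutoff_measurable cell C hmeas)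
    (cutoff_regulated cell hε C hreg) hsmall C

/-- **EXTENSIVITY WITH HYPOTHESES ON `C` ONLY** (regulated level): `Γ ⪰ 0`, `Γ ⪯ γ_op·1`, diagonal `≤ γ` (`γ ≥ 0`); disjoint cells of `≤ v`
sites; `R` symmetric with `≤ Δ` neighbours; factors regulated ON `C`; `e·εA^v·(Δ+1)² ≤ 1∕2` ⟹ `‖log Z(C)‖ ≤ #C·(Δ+1)·2e·εA^v`. [folklore] -/
theorem regulated_norm_pertLogZ_le_on {Γ : Matrix ι ι ℝ} {γop γ : ℝ} (hΓ : Γ.PosSemidef)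
    (hΓop : (γop • (1 : Matrix ι ι ℝ) - Γ).PosSemidef) (hdiag : ∀ i, Γ i i ≤ γ) (hγ : 0 ≤ γ) (cell : V → Finset ι)
    (hdisj : ∀ p q, p ≠ q → Disjoint (cell p) (cell q)) {v : ℕ} (hv : ∀ p, (cell p).card ≤ v) {R : V → V → Prop} [DecidableRel R]
    (hRsymm : ∀ x y, R x y → R y x) {nbr : V → Finset V} {Δ : ℕ} (hΔ : ∀ x, (nbr x).card ≤ Δ) (hnbr : ∀ x y, R x y → y ∈ nbr x)
    {g : V → EuclideanSpace ℝ ι → ℂ} {ε κ θ : ℝ} (hε : 0 ≤ ε) (hκ : 0 ≤ κ) (hθ0 : 0 < θ) (hθ1 : θ < 1) (hκθ : κ * γop ≤ θ)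
    (C : Finset V) (hreg : ∀ p ∈ C, ∀ ω, ‖g p ω‖ ≤ ε * exp (κ * (∑ x ∈ cell p, ω x ^ 2) / 2))
    (hsmall : Real.exp 1 * (ε * ((1 - θ) ^ (-(κ * γ / (2 * θ)))) ^ v) * ((Δ : ℝ) + 1) ^ 2 ≤ 1 / 2) :
    ‖pertLogZ (multivariateGaussian 0 Γ) g R C‖ ≤
      C.card * ((Δ : ℝ) + 1) * (2 * (Real.exp 1 * (ε * ((1 - θ) ^ (-(κ * γ / (2 * θ)))) ^ v))) := by
  rw [← pertLogZ_cutoff]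
  exact regulated_norm_pertLogZ_le hΓ hΓop hdiag hγ cell hdisj hv hRsymm hΔ hnbr hε hκ hθ0 hθ1 hκθ (cutoff_regulated cell hε C hreg)
    hsmall C

/-! ## §4. THE SMALL-FIELD REGION THEOREM -/

omit [Fintype ι] [DecidableEq ι] in
/-- On a region where the external field is small on cells, the shifted factors are regulated with the constant `ε_Ψ = εe^{½κ(1+τ⁻¹)Ψ²}`
(regulated bound for `g` assumed on the region only). [folklore] -/
theorem shifted_regulated_of_small_on (cell : V → Finset ι) {g : V → EuclideanSpace ℝ ι → ℂ} {ε κ τ Ψ : ℝ} (hε : 0 ≤ ε) (hκ : 0 ≤ κ)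
    (hτ : 0 < τ) (C : Finset V) (hreg : ∀ p ∈ C, ∀ ω, ‖g p ω‖ ≤ ε * exp (κ * (∑ x ∈ cell p, ω x ^ 2) / 2)) (ψ : EuclideanSpace ℝ ι)
    (hψ : ∀ p ∈ C, ∑ x ∈ cell p, ψ x ^ 2 ≤ Ψ ^ 2) (p : V) (hp : p ∈ C) (ω : EuclideanSpace ℝ ι) :
    ‖g p (ω + ψ)‖ ≤ (ε * exp (κ * (1 + τ⁻¹) * Ψ ^ 2 / 2)) * exp (κ * (1 + τ) * (∑ x ∈ cell p, ω x ^ 2) / 2) := by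
  -- apply (292) to the cut-off factors, which are regulated everywhere
  have h := shifted_regulated cell (g := fun p ω => if p ∈ C then g p ω else 0) hε hκ hτ (cutoff_regulated cell hε C hreg) p ψ ω
  simp only [hp, if_true] at h
  refine h.trans (mul_le_mul_of_nonneg_right ?_ (exp_pos _).le)
  refine mul_le_mul_of_nonneg_left (exp_le_exp.2 ?_) hε
  have h1 : 0 ≤ κ * (1 + τ⁻¹) := mul_nonneg hκ (by positivity)
  have := mul_le_mul_of_nonneg_left (hψ p hp) h1
  linarith

omit [Fintype ι] [DecidableEq ι] in
/-- The cut-off shifted factors are regulated everywhere with the constant `ε_Ψ` when the factors are regulated on `C` and the external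
field is small on the cells of `C`. [folklore] -/
theorem cutoff_shifted_regulated (cell : V → Finset ι) {g : V → EuclideanSpace ℝ ι → ℂ} {ε κ τ Ψ : ℝ} (hε : 0 ≤ ε) (hκ : 0 ≤ κ)
    (hτ : 0 < τ) (C : Finset V) (hreg : ∀ p ∈ C, ∀ ω, ‖g p ω‖ ≤ ε * exp (κ * (∑ x ∈ cell p, ω x ^ 2) / 2)) (ψ : EuclideanSpace ℝ ι)
    (hψ : ∀ p ∈ C, ∑ x ∈ cell p, ψ x ^ 2 ≤ Ψ ^ 2) (p : V) (ω : EuclideanSpace ℝ ι) :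
    ‖(if p ∈ C then g p (ω + ψ) else 0)‖ ≤ (ε * exp (κ * (1 + τ⁻¹) * Ψ ^ 2 / 2)) * exp (κ * (1 + τ) * (∑ x ∈ cell p, ω x ^ 2) / 2) := by
  split_ifs with hp
  · exact shifted_regulated_of_small_on cell hε hκ hτ C hreg ψ hψ p hp ω
  · rw [norm_zero]; positivity

/-- **ZERO-FREENESS ON THE SMALL-FIELD REGION**: `Γ ⪰ 0` of range `ρ`, `Γ ⪯ γ_op·1`, diagonal `≤ γ`; disjoint cells of `≤ v` sites; `R`
symmetric covering `ρ`-closeness with `≤ Δ` neighbours; factors cell-measurable and regulated on `C`; `0 < τ`, `κ(1+τ)γ_op ≤ θ < 1`;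
`Σ_{x∈cell p}ψ_x² ≤ Ψ²` for the cells `p ∈ C`; `e·ε_ΨA_τ^v·(Δ+1)² ≤ 1∕2` ⟹ `Z_ψ(C) ≠ 0`. [folklore] -/
theorem shifted_pertZ_ne_zero_on {Γ : Matrix ι ι ℝ} {γop γ : ℝ} (hΓ : Γ.PosSemidef)
    (hΓop : (γop • (1 : Matrix ι ι ℝ) - Γ).PosSemidef) (hdiag : ∀ i, Γ i i ≤ γ) (hγ : 0 ≤ γ) {dι : ι → ι → ℕ} {ρ : ℕ}
    (hfr : HasFiniteRange dι ρ Γ) (cell : V → Finset ι) (hdisj : ∀ p q, p ≠ q → Disjoint (cell p) (cell q)) {v : ℕ}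
    (hv : ∀ p, (cell p).card ≤ v) {R : V → V → Prop} [DecidableRel R] (hRsymm : ∀ x y, R x y → R y x)
    (hR : ∀ (p p' : V) (x y : ι), x ∈ cell p → y ∈ cell p' → dι x y ≤ ρ → p = p' ∨ R p p') {nbr : V → Finset V} {Δ : ℕ}
    (hΔ : ∀ x, (nbr x).card ≤ Δ) (hnbr : ∀ x y, R x y → y ∈ nbr x)
    {g : V → EuclideanSpace ℝ ι → ℂ} {ε κ τ θ Ψ : ℝ} (hε : 0 ≤ ε) (hκ : 0 ≤ κ) (hτ : 0 < τ) (hθ0 : 0 < θ) (hθ1 : θ < 1)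
    (hκθ : κ * (1 + τ) * γop ≤ θ) (C : Finset V)
    (hmeas : ∀ p ∈ C, Measurable[MeasurableSpace.comap (fun (ω : EuclideanSpace ℝ ι) (x : cell p) => ω x) inferInstance] (g p))
    (hreg : ∀ p ∈ C, ∀ ω, ‖g p ω‖ ≤ ε * exp (κ * (∑ x ∈ cell p, ω x ^ 2) / 2)) (ψ : EuclideanSpace ℝ ι)
    (hψ : ∀ p ∈ C, ∑ x ∈ cell p, ψ x ^ 2 ≤ Ψ ^ 2)
    (hsmall : Real.exp 1 * ((ε * exp (κ * (1 + τ⁻¹) * Ψ ^ 2 / 2)) * ((1 - θ) ^ (-(κ * (1 + τ) * γ / (2 * θ)))) ^ v) *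
      ((Δ : ℝ) + 1) ^ 2 ≤ 1 / 2) :
    pertZ (multivariateGaussian 0 Γ) (fun p ω => g p (ω + ψ)) C ≠ 0 := by
  rw [← pertZ_cutoff]
  exact regulated_pertZ_ne_zero hΓ hΓop hdiag hγ hfr cell hdisj hv hRsymm hR hΔ hnbr (mul_nonneg hε (exp_pos _).le)
    (mul_nonneg hκ (by linarith)) hθ0 hθ1 hκθ (shifted_measurable cell (cutoff_measurable cell C hmeas) ψ)
    (cutoff_shifted_regulated cell hε hκ hτ C hreg ψ hψ) hsmall C

/-- **THE END — THE SMALL-FIELD REGION THEOREM.**  `Γ ⪰ 0`, `Γ ⪯ γ_op·1`, diagonal `≤ γ` (`γ ≥ 0`); disjoint cells of `≤ v` sites; `R`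
symmetric with `≤ Δ` neighbours; factors regulated on the cells of `C` (`0 ≤ ε`, `0 ≤ κ`); `0 < τ`, `0 < θ < 1`, `κ(1+τ)γ_op ≤ θ`; an external
field with `Σ_{x∈cell p}ψ_x² ≤ Ψ²` FOR THE CELLS `p ∈ C`; `e·ε_ΨA_τ^v·(Δ+1)² ≤ 1∕2`, `ε_Ψ = εe^{½κ(1+τ⁻¹)Ψ²}`, `A_τ = (1−θ)^{−κ(1+τ)γ∕(2θ)}` ⟹
`‖log Z_ψ(C)‖ ≤ #C·(Δ+1)·2e·ε_ΨA_τ^v`, uniformly in the region `C` and in such `ψ`. [folklore] -/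
theorem shifted_norm_pertLogZ_le_on {Γ : Matrix ι ι ℝ} {γop γ : ℝ} (hΓ : Γ.PosSemidef)
    (hΓop : (γop • (1 : Matrix ι ι ℝ) - Γ).PosSemidef) (hdiag : ∀ i, Γ i i ≤ γ) (hγ : 0 ≤ γ) (cell : V → Finset ι)
    (hdisj : ∀ p q, p ≠ q → Disjoint (cell p) (cell q)) {v : ℕ} (hv : ∀ p, (cell p).card ≤ v) {R : V → V → Prop} [DecidableRel R]
    (hRsymm : ∀ x y, R x y → R y x) {nbr : V → Finset V} {Δ : ℕ} (hΔ : ∀ x, (nbr x).card ≤ Δ) (hnbr : ∀ x y, R x y → y ∈ nbr x)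
    {g : V → EuclideanSpace ℝ ι → ℂ} {ε κ τ θ Ψ : ℝ} (hε : 0 ≤ ε) (hκ : 0 ≤ κ) (hτ : 0 < τ) (hθ0 : 0 < θ) (hθ1 : θ < 1)
    (hκθ : κ * (1 + τ) * γop ≤ θ) (C : Finset V) (hreg : ∀ p ∈ C, ∀ ω, ‖g p ω‖ ≤ ε * exp (κ * (∑ x ∈ cell p, ω x ^ 2) / 2))
    (ψ : EuclideanSpace ℝ ι) (hψ : ∀ p ∈ C, ∑ x ∈ cell p, ψ x ^ 2 ≤ Ψ ^ 2)
    (hsmall : Real.exp 1 * ((ε * exp (κ * (1 + τ⁻¹) * Ψ ^ 2 / 2)) * ((1 - θ) ^ (-(κ * (1 + τ) * γ / (2 * θ)))) ^ v) *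
      ((Δ : ℝ) + 1) ^ 2 ≤ 1 / 2) :
    ‖pertLogZ (multivariateGaussian 0 Γ) (fun p ω => g p (ω + ψ)) R C‖ ≤
      C.card * ((Δ : ℝ) + 1) *
        (2 * (Real.exp 1 * ((ε * exp (κ * (1 + τ⁻¹) * Ψ ^ 2 / 2)) * ((1 - θ) ^ (-(κ * (1 + τ) * γ / (2 * θ)))) ^ v))) :=
  regulated_norm_pertLogZ_le_on hΓ hΓop hdiag hγ cell hdisj hv hRsymm hΔ hnbr (mul_nonneg hε (exp_pos _).le)
    (mul_nonneg hκ (by linarith)) hθ0 hθ1 hκθ C (fun p hp ω => shifted_regulated_of_small_on cell hε hκ hτ C hreg ψ hψ p hp ω) hsmall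

end Regulated

/-! ## §5. Toy -/

/-- Toy (§1): cutting off outside `C = ∅` leaves `Z(∅) = Z(∅)` (both are `∫ 1`). -/
example (μ : Measure Ω) (g : V → Ω → ℂ) : pertZ μ (fun p ω => if p ∈ (∅ : Finset V) then g p ω else 0) ∅ = pertZ μ g ∅ :=
  pertZ_cutoff μ g ∅

end Summit.QuantumFields.BalabanUV.T4Continuum.NE7b.SupLocalisedPolymerGas
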